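import Literature.Analysis.FluidPDE.PalasekObukhovBlowup

/-!
# Palasek 2026, §3.1: the parameter schedule of the trapping region and the (exp_small) facts

Transcription of the parameter bookkeeping of S. Palasek, *Finite-time blow-up in an elementary
model of the 3D Navier–Stokes equations*, arXiv:2605.13827 (2026), §3.1 (p. 8), for the proof of
Theorem 1.3 (`Literature.Analysis.FluidPDE.Palasek2026_viscousBlowup`):

* the amplitudes `A_k = N_k^β` (`amp`), the "small dimensionless parameter" `δ_k = (N_k/N_{k+1})^{2α}`
  of (delta_def) (`delta`), the lifespan `T = c/A_0` (`horizon`) and the activation times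
  `t_1 = t_2 = -T`, `t_k = -c/A_{k-2}` (`tAct`; the single formula `-c/A_{k∸2}` with truncated
  subtraction reproduces all three clauses of (tk_times_def));
* their closed forms `N_k = e^{b^k log N₀}`, `A_k = e^{β b^k log N₀}`, `δ_k = e^{-2α(b-1) b^k log N₀}`,
  positivity and monotonicity ("Since `A_k` is increasing, `-T = t_1 = t_2 < t_3 < ⋯ < 0`");
* the two "elementary facts" (exp_small) and (ratios) of p. 8 in the form in which the proof uses
  them: a master limit `e^{Dv} · e^{-κ e^{γ v}} → 0` (`tendsto_exp_mul_exp_neg_exp`) and a transfer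
  lemma (`eventually_forall_log_scale`) turning a property of all large `v` into a property of
  `v = b^k log N₀ = log N_k` for all `k`, once `N₀` is large ("we may take `N₀ > 1` large to arrange
  that … is arbitrarily small, uniformly in `k ≥ 0`");
* the concrete smallness conditions consumed by the barrier lemmas of
  `PalasekObukhovBarriers.lean` and by the trapping argument of Prop. 3.3/3.4, each proved to hold
  for all sufficiently large `N₀`, uniformly in the level: (S1), (S2) (Lemma 3.2, Case 1/Case 2 of the
  (z_bound) induction), (V1), (V2) (the `k = 0` step, viscous case), (S3) ((eta_global_bound)),
  (S4) (the face `x_k = ζ_k`, `t < t_k`, `k ≥ 3`, p. 9), (visc) (`N_k² ≤ ¼A_{k-1}`, Prop. 3.4, using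
  `β > 2b`), and the numerical condition (C0) `¾ ≤ e^{-2c}` on the small constant `c`.

Everything here is a definition with a body or a proved theorem; no named facts. Viscosity `ν` is
carried as a parameter (the source rescales to `ν = 1`). Plan: cell `pub/ns-blowup`,
`lit/PALASEK-FORMALISATION.md` §1.
-/

open Set Filter Topology

namespace Literature.Analysis.FluidPDE

namespace PalasekObukhov

/-! ### The schedule: amplitudes, interaction coefficients, lifespan, activation times -/

/-- The amplitudes `A_k = N_k^β` of the trapping region ("an increasing sequence of amplitudes").
[cite: Palasek2026ElementaryModel, §3.1 p. 8] -/
noncomputable def amp (N₀ b β : ℝ) (k : ℕ) : ℝ :=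
  scale N₀ b k ^ β

/-- The coefficient `δ_k = (N_k/N_{k+1})^{2α}` of the rescaled system (x_system), (delta_def).
[cite: Palasek2026ElementaryModel, §3 (delta_def) p. 8] -/
noncomputable def delta (N₀ b α : ℝ) (k : ℕ) : ℝ :=
  (scale N₀ b k / scale N₀ b (k + 1)) ^ (2 * α)

/-- The lifespan `T = c/A_0` of (tk_times_def). [cite: Palasek2026ElementaryModel, §3.1 (tk_times_def) p. 8] -/
noncomputable def horizon (N₀ b β c : ℝ) : ℝ :=
  c / amp N₀ b β 0

/-- The activation times of (tk_times_def): `t_1 = t_2 = -T`, `t_k = -c/A_{k-2}` for `k ≥ 3`; written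
as the single formula `-c/A_{k∸2}` (truncated subtraction), which also assigns `t_0 = -T`.
[cite: Palasek2026ElementaryModel, §3.1 (tk_times_def) p. 8] -/
noncomputable def tAct (N₀ b β c : ℝ) (k : ℕ) : ℝ :=
  -(c / amp N₀ b β (k - 2))

/-! ### Closed forms and elementary properties -/

section Schedule

variable {N₀ b β α c : ℝ}

/-- `N_k = exp(b^k log N₀)`, i.e. `log N_k = b^k log N₀`. [cite: Palasek2026ElementaryModel, §1.2 (nk_choice)] -/
theorem scale_eq_exp (hN₀ : 0 < N₀) (b : ℝ) (k : ℕ) :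
    scale N₀ b k = Real.exp (b ^ k * Real.log N₀) := by
  rw [scale, Real.rpow_def_of_pos hN₀, mul_comm]

/-- `A_k = exp(β b^k log N₀)`. [cite: Palasek2026ElementaryModel, §3.1 p. 8] -/
theorem amp_eq_exp (hN₀ : 0 < N₀) (b β : ℝ) (k : ℕ) :
    amp N₀ b β k = Real.exp (β * b ^ k * Real.log N₀) := by
  rw [amp, scale_eq_exp hN₀, ← Real.exp_mul]
  congr 1; ring

/-- `δ_k = exp(-2α(b-1) b^k log N₀) = (N_{k+1}/N_k)^{-2α}`. [cite: Palasek2026ElementaryModel, §3 (delta_def) p. 8] -/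
theorem delta_eq_exp (hN₀ : 0 < N₀) (b α : ℝ) (k : ℕ) :
    delta N₀ b α k = Real.exp (-(2 * α * (b - 1)) * b ^ k * Real.log N₀) := by
  rw [delta, scale_eq_exp hN₀, scale_eq_exp hN₀, ← Real.exp_sub, ← Real.exp_mul]
  congr 1; ring

/-- `A_k > 0`. [cite: Palasek2026ElementaryModel, §3.1 p. 8] -/
theorem amp_pos (hN₀ : 0 < N₀) (b β : ℝ) (k : ℕ) : 0 < amp N₀ b β k :=
  Real.rpow_pos_of_pos (scale_pos hN₀ b k) β

/-- `δ_k > 0`. [cite: Palasek2026ElementaryModel, §3 (delta_def) p. 8] -/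
theorem delta_pos (hN₀ : 0 < N₀) (b α : ℝ) (k : ℕ) : 0 < delta N₀ b α k :=
  Real.rpow_pos_of_pos (div_pos (scale_pos hN₀ b k) (scale_pos hN₀ b (k + 1))) _

/-- `A_0 = N₀^β`. [cite: Palasek2026ElementaryModel, §3.1 p. 8] -/
@[simp] theorem amp_zero (N₀ b β : ℝ) : amp N₀ b β 0 = N₀ ^ β := by
  simp [amp]

/-- `A_k ≥ 1` for `N₀ ≥ 1`, `b ≥ 1`, `β ≥ 0`. [cite: Palasek2026ElementaryModel, §3.1 p. 8] -/
theorem one_le_amp (hN₀ : 1 ≤ N₀) (hb : 1 ≤ b) (hβ : 0 ≤ β) (k : ℕ) : 1 ≤ amp N₀ b β k := by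
  rw [amp_eq_exp (by linarith) b β k]
  have hb0 : 0 < b := by linarith
  exact Real.one_le_exp (by have := Real.log_nonneg hN₀; positivity)

/-- "Since `A_k` is increasing": `k ↦ A_k` is monotone for `N₀ ≥ 1`, `b ≥ 1`, `β ≥ 0`.
[cite: Palasek2026ElementaryModel, §3.1 p. 8] -/
theorem amp_mono (hN₀ : 1 ≤ N₀) (hb : 1 ≤ b) (hβ : 0 ≤ β) : Monotone (amp N₀ b β) := by
  intro k j hkj
  rw [amp_eq_exp (by linarith) b β k, amp_eq_exp (by linarith) b β j, Real.exp_le_exp]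
  have hL := Real.log_nonneg hN₀
  have : b ^ k ≤ b ^ j := pow_le_pow_right₀ hb hkj
  have : β * b ^ k ≤ β * b ^ j := mul_le_mul_of_nonneg_left this hβ
  exact mul_le_mul_of_nonneg_right this hL

/-- The ratio of consecutive amplitudes: `A_{k+1}/A_k = exp(β(b-1) b^k log N₀) = N_k^{β(b-1)}`.
[cite: Palasek2026ElementaryModel, §3.1 (ratios) p. 8] -/
theorem amp_succ_div (hN₀ : 0 < N₀) (b β : ℝ) (k : ℕ) :
    amp N₀ b β (k + 1) / amp N₀ b β k = Real.exp (β * (b - 1) * b ^ k * Real.log N₀) := by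
  rw [amp_eq_exp hN₀, amp_eq_exp hN₀, ← Real.exp_sub]
  congr 1; ring

/-- The ratios `A_{k+1}/A_k` increase with `k` ("`A_{k+1}/A_k` … grows", (ratios)); with the truncated
index this reads `A_k/A_{k∸1} ≤ A_{k+1}/A_k` for every `k` (for `k = 0` the left side is `1`).
[cite: Palasek2026ElementaryModel, §3.1 (ratios) p. 8] -/
theorem amp_div_pred_le (hN₀ : 1 ≤ N₀) (hb : 1 ≤ b) (hβ : 0 ≤ β) (k : ℕ) :
    amp N₀ b β k / amp N₀ b β (k - 1) ≤ amp N₀ b β (k + 1) / amp N₀ b β k := by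
  have hN₀0 : 0 < N₀ := by linarith
  rcases k with _ | j
  · rw [Nat.zero_sub, div_self (amp_pos hN₀0 b β 0).ne', one_le_div (amp_pos hN₀0 b β 0)]
    exact amp_mono hN₀ hb hβ (Nat.zero_le 1)
  · rw [Nat.add_sub_cancel, amp_succ_div hN₀0, amp_succ_div hN₀0, Real.exp_le_exp]
    have hL := Real.log_nonneg hN₀
    have h1 : b ^ j ≤ b ^ (j + 1) := pow_le_pow_right₀ hb (Nat.le_succ j)
    have h2 : 0 ≤ β * (b - 1) := mul_nonneg hβ (by linarith)
    have : β * (b - 1) * b ^ j ≤ β * (b - 1) * b ^ (j + 1) := mul_le_mul_of_nonneg_left h1 h2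
    exact mul_le_mul_of_nonneg_right this hL

/-- `T > 0`. [cite: Palasek2026ElementaryModel, §3.1 (tk_times_def) p. 8] -/
theorem horizon_pos (hN₀ : 0 < N₀) (hc : 0 < c) (b β : ℝ) : 0 < horizon N₀ b β c :=
  div_pos hc (amp_pos hN₀ b β 0)

/-- `t_0 = -T` (the value assigned by the truncated formula). [cite: Palasek2026ElementaryModel, §3.1 (tk_times_def) p. 8] -/
theorem tAct_zero (N₀ b β c : ℝ) : tAct N₀ b β c 0 = -horizon N₀ b β c := rfl

/-- `t_1 = -T`. [cite: Palasek2026ElementaryModel, §3.1 (tk_times_def) p. 8] -/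
theorem tAct_one (N₀ b β c : ℝ) : tAct N₀ b β c 1 = -horizon N₀ b β c := rfl

/-- `t_2 = -T`. [cite: Palasek2026ElementaryModel, §3.1 (tk_times_def) p. 8] -/
theorem tAct_two (N₀ b β c : ℝ) : tAct N₀ b β c 2 = -horizon N₀ b β c := rfl

/-- `t_{k+2} = -c/A_k`. [cite: Palasek2026ElementaryModel, §3.1 (tk_times_def) p. 8] -/
theorem tAct_add_two (N₀ b β c : ℝ) (k : ℕ) : tAct N₀ b β c (k + 2) = -(c / amp N₀ b β k) := by
  simp [tAct]

/-- `t_k ≤ 0`. [cite: Palasek2026ElementaryModel, §3.1 (tk_times_def) p. 8] -/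
theorem tAct_le_zero (hN₀ : 0 < N₀) (hc : 0 ≤ c) (b β : ℝ) (k : ℕ) : tAct N₀ b β c k ≤ 0 :=
  neg_nonpos.mpr (div_nonneg hc (amp_pos hN₀ b β _).le)

/-- `-t_k ≤ c` for `N₀ ≥ 1`, `b ≥ 1`, `β ≥ 0` (since `A_{k∸2} ≥ 1`). [cite: Palasek2026ElementaryModel, §3.1 (tk_times_def) p. 8] -/
theorem neg_tAct_le (hN₀ : 1 ≤ N₀) (hb : 1 ≤ b) (hβ : 0 ≤ β) (hc : 0 ≤ c) (k : ℕ) :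
    -tAct N₀ b β c k ≤ c := by
  rw [tAct, neg_neg]
  exact div_le_self hc (one_le_amp hN₀ hb hβ _)

/-- "`-T = t_1 = t_2 < t_3 < t_4 < ⋯ < 0`": the activation times are monotone in `k`.
[cite: Palasek2026ElementaryModel, §3.1 (tk_times_def) p. 8] -/
theorem tAct_mono (hN₀ : 1 ≤ N₀) (hb : 1 ≤ b) (hβ : 0 ≤ β) (hc : 0 ≤ c) :
    Monotone (tAct N₀ b β c) := by
  intro k j hkj
  have hN₀0 : 0 < N₀ := by linarith
  simp only [tAct, neg_le_neg_iff]
  exact div_le_div_of_nonneg_left hc (amp_pos hN₀0 b β _)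
    (amp_mono hN₀ hb hβ (Nat.sub_le_sub_right hkj 2))

/-- `-T ≤ t_k`. [cite: Palasek2026ElementaryModel, §3.1 (tk_times_def) p. 8] -/
theorem neg_horizon_le_tAct (hN₀ : 1 ≤ N₀) (hb : 1 ≤ b) (hβ : 0 ≤ β) (hc : 0 ≤ c) (k : ℕ) :
    -horizon N₀ b β c ≤ tAct N₀ b β c k := by
  rw [← tAct_zero]
  exact tAct_mono hN₀ hb hβ hc (Nat.zero_le k)

end Schedule

/-! ### (exp_small): "the exponential defeats the polynomial prefactor" -/

/-- The mechanism behind (exp_small): for `κ, γ > 0` and any `D`,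
`exp(D v) · exp(-κ exp(γ v)) → 0` as `v → ∞` (a power of `N = e^{v}` against `exp(-κ N^{γ})`).
[cite: Palasek2026ElementaryModel, §3.1 (exp_small) p. 8] -/
theorem tendsto_exp_mul_exp_neg_exp (D : ℝ) {κ γ : ℝ} (hκ : 0 < κ) (hγ : 0 < γ) :
    Tendsto (fun v : ℝ => Real.exp (D * v) * Real.exp (-(κ * Real.exp (γ * v)))) atTop (𝓝 0) := by
  have h := (tendsto_rpow_mul_exp_neg_mul_atTop_nhds_zero (D / γ) κ hκ).comp
    (Real.tendsto_exp_atTop.comp (tendsto_id.const_mul_atTop hγ))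
  refine h.congr' (Eventually.of_forall fun v => ?_)
  simp only [Function.comp, id]
  rw [← Real.exp_mul, neg_mul]
  congr 2
  field_simp

/-- `exp(-κ v) → 0` (`κ > 0`): the purely polynomial instances of (exp_small), e.g.
`δ_k A_{k+1}²/A_k² = N_0^{-2(α-β)(b-1)b^k}`. [cite: Palasek2026ElementaryModel, §3.1 p. 8] -/
theorem tendsto_exp_neg_mul {κ : ℝ} (hκ : 0 < κ) :
    Tendsto (fun v : ℝ => Real.exp (-(κ * v))) atTop (𝓝 0) :=
  Real.tendsto_exp_neg_atTop_nhds_zero.comp (tendsto_id.const_mul_atTop hκ)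

/-- Comparison of two super-exponential rates: for `γ₁ < γ₂` and `κ > 0`, eventually
`p exp(γ₁ v) ≤ κ exp(γ₂ v)` (used as `A_{k-1}/A_{k-2} ≪ A_k/A_{k-1}`, (ratios)).
[cite: Palasek2026ElementaryModel, §3.1 (ratios) p. 8] -/
theorem eventually_mul_exp_le_mul_exp (p : ℝ) {κ γ₁ γ₂ : ℝ} (hκ : 0 < κ) (hγ : γ₁ < γ₂) :
    ∀ᶠ v : ℝ in atTop, p * Real.exp (γ₁ * v) ≤ κ * Real.exp (γ₂ * v) := by
  have h := (Real.tendsto_exp_atTop.comp (tendsto_id.const_mul_atTop (sub_pos.2 hγ))).eventually_ge_atTop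
    (p / κ)
  filter_upwards [h] with v hv
  simp only [Function.comp, id] at hv
  rw [div_le_iff₀ hκ] at hv
  calc p * Real.exp (γ₁ * v) ≤ Real.exp ((γ₂ - γ₁) * v) * κ * Real.exp (γ₁ * v) :=
        mul_le_mul_of_nonneg_right hv (Real.exp_pos _).le
    _ = κ * Real.exp (γ₂ * v) := by
        rw [mul_comm _ κ, mul_assoc, ← Real.exp_add]; congr 2; ring

/-- Transfer ("uniformly in `k ≥ 0`" once "`N₀ > 1` large"): if a property holds for all large `v`,
then for all large `N₀` it holds at `v = b^k log N₀ = log N_k` for every `k` (`b ≥ 1`).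
[cite: Palasek2026ElementaryModel, §3.1 (exp_small) p. 8] -/
theorem eventually_forall_log_scale {b : ℝ} (hb : 1 ≤ b) {P : ℝ → Prop} (hP : ∀ᶠ v in atTop, P v) :
    ∀ᶠ N₀ : ℝ in atTop, ∀ k : ℕ, P (b ^ k * Real.log N₀) := by
  obtain ⟨v₀, hv₀⟩ := eventually_atTop.1 hP
  filter_upwards [Real.tendsto_log_atTop.eventually_ge_atTop (max v₀ 0)] with N₀ hN₀ k
  apply hv₀
  have hL0 : 0 ≤ Real.log N₀ := le_trans (le_max_right _ _) hN₀
  calc v₀ ≤ max v₀ 0 := le_max_left _ _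
    _ ≤ Real.log N₀ := hN₀
    _ = 1 * Real.log N₀ := (one_mul _).symm
    _ ≤ b ^ k * Real.log N₀ := mul_le_mul_of_nonneg_right (one_le_pow₀ hb) hL0

/-- Transfer in `k` for fixed `N₀ > 1`, `b > 1`: `b^k log N₀ → ∞`, so (exp_small)-type quantities also
tend to `0` along the levels (used for the `𝒞^σ`-regularity of `X(t)`, `t < 0`, and the force tail).
[cite: Palasek2026ElementaryModel, §3.2 p. 10] -/
theorem tendsto_log_scale_atTop {N₀ b : ℝ} (hN₀ : 1 < N₀) (hb : 1 < b) :
    Tendsto (fun k : ℕ => b ^ k * Real.log N₀) atTop atTop :=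
  (tendsto_pow_atTop_atTop_of_one_lt hb).atTop_mul_const (Real.log_pos hN₀)

/-! ### The smallness conditions, for all large `N₀`, uniformly in the level -/

section Smallness

variable {b β α c ν ε : ℝ}

/-- `(e^x)² = e^{2x}`. [folklore] -/
private theorem exp_sq (x : ℝ) : Real.exp x ^ 2 = Real.exp (2 * x) := by
  rw [sq, ← Real.exp_add, two_mul]

/-- (S2), the Case-2 / second-term condition of the (z_bound) induction, from
`δ_k A_{k+1}²/A_k² = N_0^{-2(α-β)(b-1)b^k}` and `β < α`: for every `ε > 0`, for all large `N₀`,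
`8 δ_k A_{k+1}² ≤ ε A_k²` for all `k`. [cite: Palasek2026ElementaryModel, Lemma 3.2 proof, p. 8] -/
theorem eventually_S2 (hb : 1 < b) (hβα : β < α) (hε : 0 < ε) :
    ∀ᶠ N₀ : ℝ in atTop, ∀ k : ℕ,
      8 * delta N₀ b α k * amp N₀ b β (k + 1) ^ 2 ≤ ε * amp N₀ b β k ^ 2 := by
  have hκ : 0 < 2 * (α - β) * (b - 1) := by nlinarith [sub_pos.2 hβα, sub_pos.2 hb]
  have hP : ∀ᶠ v : ℝ in atTop, 8 * Real.exp (-(2 * (α - β) * (b - 1) * v)) ≤ ε := by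
    have h := (tendsto_exp_neg_mul hκ).const_mul 8
    rw [mul_zero] at h
    filter_upwards [h.eventually (gt_mem_nhds hε)] with v hv using hv.le
  filter_upwards [eventually_forall_log_scale hb.le hP, eventually_gt_atTop 0] with N₀ hN₀ hN₀0 k
  set L := Real.log N₀
  rw [delta_eq_exp hN₀0, amp_eq_exp hN₀0, amp_eq_exp hN₀0, exp_sq, exp_sq]
  have key : Real.exp (-(2 * α * (b - 1)) * b ^ k * L) * Real.exp (2 * (β * b ^ (k + 1) * L)) =
      Real.exp (-(2 * (α - β) * (b - 1) * (b ^ k * L))) * Real.exp (2 * (β * b ^ k * L)) := by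
    rw [← Real.exp_add, ← Real.exp_add]; congr 1; ring
  calc 8 * Real.exp (-(2 * α * (b - 1)) * b ^ k * L) * Real.exp (2 * (β * b ^ (k + 1) * L))
        = 8 * Real.exp (-(2 * (α - β) * (b - 1) * (b ^ k * L))) * Real.exp (2 * (β * b ^ k * L)) := by
          rw [mul_assoc, key, ← mul_assoc]
    _ ≤ ε * Real.exp (2 * (β * b ^ k * L)) :=
          mul_le_mul_of_nonneg_right (hN₀ k) (Real.exp_pos _).le

/-- (V2), the `k = 0` step of Lemma 3.2 (`A_0 + 4δ_0A_1²/A_0 ≤ (1 + o(1))A_0`): for all large `N₀`,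
`12 δ_0 A_1² ≤ A_0²`. [cite: Palasek2026ElementaryModel, Lemma 3.2 proof (k = 0), p. 9] -/
theorem eventually_V2 (hb : 1 < b) (hβα : β < α) :
    ∀ᶠ N₀ : ℝ in atTop, 12 * delta N₀ b α 0 * amp N₀ b β 1 ^ 2 ≤ amp N₀ b β 0 ^ 2 := by
  filter_upwards [eventually_S2 hb hβα (by norm_num : (0:ℝ) < 2 / 3)] with N₀ hN₀
  have := hN₀ 0
  linarith

/-- (V1), the viscous prefactor of the `k = 0` step (`e^{ν c N_0²/A_0}`, "`cN_0^{2-β} ≤ 1/10`, say",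
using `β > 2`): for all large `N₀`, `exp(ν N₀² T) ≤ 3/2`.
[cite: Palasek2026ElementaryModel, Lemma 3.2 proof (k = 0), p. 9] -/
theorem eventually_V1 (hβ : 2 < β) (ν c b : ℝ) :
    ∀ᶠ N₀ : ℝ in atTop, Real.exp (ν * N₀ ^ 2 * horizon N₀ b β c) ≤ 3 / 2 := by
  have h1 : Tendsto (fun N₀ : ℝ => ν * c * N₀ ^ (-(β - 2))) atTop (𝓝 (ν * c * 0)) :=
    (tendsto_rpow_neg_atTop (sub_pos.2 hβ)).const_mul _
  rw [mul_zero] at h1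
  have h2 : Tendsto (fun N₀ : ℝ => Real.exp (ν * c * N₀ ^ (-(β - 2)))) atTop (𝓝 (Real.exp 0)) :=
    (Real.continuous_exp.tendsto 0).comp h1
  rw [Real.exp_zero] at h2
  filter_upwards [h2.eventually (gt_mem_nhds (by norm_num : (1:ℝ) < 3 / 2)), eventually_gt_atTop 0]
    with N₀ hN₀ hN₀0
  refine le_of_eq_of_le ?_ hN₀.le
  have hβ0 : N₀ ^ β ≠ 0 := (Real.rpow_pos_of_pos hN₀0 β).ne'
  have h20 : N₀ ^ (2:ℕ) ≠ 0 := by positivity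
  have e : N₀ ^ (-(β - 2)) = N₀ ^ (2:ℕ) / N₀ ^ β := by
    rw [Real.rpow_neg hN₀0.le, Real.rpow_sub hN₀0, Real.rpow_two, inv_div]
  rw [e, horizon, amp_zero]
  congr 1
  field_simp

/-- (C0), the choice of the small constant: `¾ ≤ e^{-2c}` for `0 ≤ c ≤ 1/10` ("we conclude
(eta_quarter_bound) once again by the choice of `c > 0`").
[cite: Palasek2026ElementaryModel, Lemma 3.2 proof, p. 9] -/
theorem three_quarters_le_exp (hc : c ≤ 1 / 10) : 3 / 4 ≤ Real.exp (-(2 * c)) := by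
  have := Real.add_one_le_exp (-(2 * c))
  linarith

/-- (S1), the Case-1 / first-term condition of the (z_bound) induction
(`δ_kA_{k+1}²|t_k| e^{A_kt_{k+1} - ½A_{k-1}t_k} ≲ o(1) A_k e^{½A_{k-1}t_k}`), at level `k+1`:
for every `ε > 0` and `c > 0`, for all large `N₀` and all `k`,
`4 δ_{k+1} A_{k+2}² (-t_{k+1}) e^{A_{k+1} t_{k+2}} ≤ ε A_{k+1} e^{½ A_k t_{k+1}}`.
[cite: Palasek2026ElementaryModel, Lemma 3.2 proof (Case 1), p. 8] -/
theorem eventually_S1 (hb : 1 < b) (hβ : 0 < β) (hc : 0 < c) (hε : 0 < ε) (α : ℝ) :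
    ∀ᶠ N₀ : ℝ in atTop, ∀ k : ℕ,
      4 * delta N₀ b α (k + 1) * amp N₀ b β (k + 2) ^ 2 * (-tAct N₀ b β c (k + 1)) *
          Real.exp (amp N₀ b β (k + 1) * tAct N₀ b β c (k + 2)) ≤
        ε * amp N₀ b β (k + 1) * Real.exp (amp N₀ b β k / 2 * tAct N₀ b β c (k + 1)) := by
  -- the polynomial prefactor exponent and the super-exponential rate `γ = β(b-1)` (`A_{k+1}/A_k = e^{γ v}`)
  set D := 2 * β * b ^ 2 - β * b - 2 * α * (b - 1) * b with hD
  have hγ : 0 < β * (b - 1) := mul_pos hβ (sub_pos.2 hb)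
  have hP : ∀ᶠ v : ℝ in atTop,
      4 * c * (Real.exp (D * v) * Real.exp (-(c / 2 * Real.exp (β * (b - 1) * v)))) ≤ ε := by
    have h := (tendsto_exp_mul_exp_neg_exp D (half_pos hc) hγ).const_mul (4 * c)
    rw [mul_zero] at h
    filter_upwards [h.eventually (gt_mem_nhds hε)] with v hv using hv.le
  filter_upwards [eventually_forall_log_scale hb.le hP, eventually_ge_atTop 1] with N₀ hN₀ hN₀1 k
  have hN₀0 : 0 < N₀ := by linarith
  set L := Real.log N₀ with hL
  set v := b ^ k * L with hv
  set r := Real.exp (β * (b - 1) * v) with hr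
  have hr' : amp N₀ b β (k + 1) / amp N₀ b β k = r := by rw [amp_succ_div hN₀0]; congr 1; ring
  -- Step 1: `-t_{k+1} ≤ c` and `A_{k+1} t_{k+2} = -c r`.
  have ht1 : -tAct N₀ b β c (k + 1) ≤ c := neg_tAct_le hN₀1 hb.le hβ.le hc.le (k + 1)
  have ht2 : amp N₀ b β (k + 1) * tAct N₀ b β c (k + 2) = -(c * r) := by
    rw [tAct_add_two, ← hr']; ring
  -- Step 2: `½ A_k t_{k+1} ≥ -(c/2) r` by monotonicity of the ratios.
  have ht3 : -(c / 2 * r) ≤ amp N₀ b β k / 2 * tAct N₀ b β c (k + 1) := by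
    have hk : amp N₀ b β k / amp N₀ b β (k - 1) ≤ r := by
      rw [← hr']; exact amp_div_pred_le hN₀1 hb.le hβ.le k
    have e : k + 1 - 2 = k - 1 := by omega
    have : amp N₀ b β k / 2 * tAct N₀ b β c (k + 1) =
        -(c / 2 * (amp N₀ b β k / amp N₀ b β (k - 1))) := by
      simp only [tAct, e]; ring
    rw [this, neg_le_neg_iff]
    exact mul_le_mul_of_nonneg_left hk (by positivity)
  -- Step 3: the closed forms.
  have hδ : delta N₀ b α (k + 1) = Real.exp (-(2 * α * (b - 1)) * b * v) := by
    rw [delta_eq_exp hN₀0]; congr 1; rw [hv]; ring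
  have hA2 : amp N₀ b β (k + 2) ^ 2 = Real.exp (2 * β * b ^ 2 * v) := by
    rw [amp_eq_exp hN₀0, exp_sq]; congr 1; rw [hv]; ring
  have hA1 : amp N₀ b β (k + 1) = Real.exp (β * b * v) := by
    rw [amp_eq_exp hN₀0]; congr 1; rw [hv]; ring
  have hpos1 : 0 ≤ 4 * delta N₀ b α (k + 1) * amp N₀ b β (k + 2) ^ 2 := by
    have := delta_pos hN₀0 b α (k + 1); positivity
  -- Step 4: assemble.
  calc 4 * delta N₀ b α (k + 1) * amp N₀ b β (k + 2) ^ 2 * (-tAct N₀ b β c (k + 1)) *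
          Real.exp (amp N₀ b β (k + 1) * tAct N₀ b β c (k + 2))
        ≤ 4 * delta N₀ b α (k + 1) * amp N₀ b β (k + 2) ^ 2 * c * Real.exp (-(c * r)) := by
          rw [ht2]
          exact mul_le_mul_of_nonneg_right (mul_le_mul_of_nonneg_left ht1 hpos1) (Real.exp_pos _).le
    _ = 4 * c * (Real.exp (D * v) * Real.exp (-(c / 2 * Real.exp (β * (b - 1) * v)))) *
          (Real.exp (β * b * v) * Real.exp (-(c / 2 * r))) := by
          rw [hδ, hA2, hr]
          have e1 : Real.exp (-(c * Real.exp (β * (b - 1) * v))) =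
              Real.exp (-(c / 2 * Real.exp (β * (b - 1) * v))) *
                Real.exp (-(c / 2 * Real.exp (β * (b - 1) * v))) := by
            rw [← Real.exp_add]; congr 1; ring
          have e2 : Real.exp (-(2 * α * (b - 1)) * b * v) * Real.exp (2 * β * b ^ 2 * v) =
              Real.exp (D * v) * Real.exp (β * b * v) := by
            rw [← Real.exp_add, ← Real.exp_add]; congr 1; rw [hD]; ring
          calc 4 * Real.exp (-(2 * α * (b - 1)) * b * v) * Real.exp (2 * β * b ^ 2 * v) * c *
                Real.exp (-(c * Real.exp (β * (b - 1) * v)))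
              = 4 * c * (Real.exp (-(2 * α * (b - 1)) * b * v) * Real.exp (2 * β * b ^ 2 * v)) *
                Real.exp (-(c * Real.exp (β * (b - 1) * v))) := by ring
            _ = _ := by rw [e2, e1]; ring
    _ ≤ ε * (Real.exp (β * b * v) * Real.exp (-(c / 2 * r))) :=
          mul_le_mul_of_nonneg_right (hN₀ k) (by positivity)
    _ ≤ ε * amp N₀ b β (k + 1) * Real.exp (amp N₀ b β k / 2 * tAct N₀ b β c (k + 1)) := by
          rw [hA1, mul_assoc ε]
          exact mul_le_mul_of_nonneg_left
            (mul_le_mul_of_nonneg_left (Real.exp_le_exp.2 ht3) (Real.exp_pos _).le) hε.le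

/-- (S3), the (exp_small) instance of the (eta_global_bound) step
(`A_{k-1}T e^{-(c/2)A_{k-2}/A_{k-3}} ≲ o(1)·A_{k-1}/A_{k-2}`, p. 9), at level `k+2`: for
`0 < c ≤ 1/2`, for all large `N₀` and all `k`, `2 T A_k e^{½ A_k t_{k+1}} ≤ 1`.
[cite: Palasek2026ElementaryModel, Lemma 3.2 proof ((eta_global_bound), k ≥ 3), p. 9] -/
theorem eventually_S3 (hb : 1 < b) (hβ : 0 < β) (hc : 0 < c) (hc2 : c ≤ 1 / 2) :
    ∀ᶠ N₀ : ℝ in atTop, ∀ k : ℕ,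
      2 * horizon N₀ b β c * amp N₀ b β k *
          Real.exp (amp N₀ b β k / 2 * tAct N₀ b β c (k + 1)) ≤ 1 := by
  have hγ : 0 < β * (b - 1) := mul_pos hβ (sub_pos.2 hb)
  have hP : ∀ᶠ v : ℝ in atTop,
      2 * c * (Real.exp (β * b * v) * Real.exp (-(c / 2 * Real.exp (β * (b - 1) * v)))) ≤ 1 := by
    have h := (tendsto_exp_mul_exp_neg_exp (β * b) (half_pos hc) hγ).const_mul (2 * c)
    rw [mul_zero] at h
    filter_upwards [h.eventually (gt_mem_nhds (by norm_num : (0:ℝ) < 1))] with v hv using hv.le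
  filter_upwards [eventually_forall_log_scale hb.le hP, eventually_ge_atTop 1] with N₀ hN₀ hN₀1 k
  have hN₀0 : 0 < N₀ := by linarith
  have hL := Real.log_nonneg hN₀1
  rcases k with _ | j
  · -- level 2: `2c e^{-c/2} ≤ 2c ≤ 1`
    have hA := amp_pos hN₀0 b β 0
    have e : 2 * horizon N₀ b β c * amp N₀ b β 0 = 2 * c := by
      rw [horizon]; field_simp
    rw [e]
    have : Real.exp (amp N₀ b β 0 / 2 * tAct N₀ b β c (0 + 1)) ≤ 1 := by
      rw [Real.exp_le_one_iff, tAct_one, horizon]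
      have : amp N₀ b β 0 / 2 * -(c / amp N₀ b β 0) = -(c / 2) := by field_simp
      rw [this]; linarith
    calc 2 * c * Real.exp _ ≤ 2 * c * 1 := mul_le_mul_of_nonneg_left this (by positivity)
      _ ≤ 1 := by linarith
  · -- level j+3: `2c (A_{j+1}/A_0) e^{-(c/2) A_{j+1}/A_j} ≤ 2c e^{βb v} e^{-(c/2)e^{β(b-1)v}} ≤ 1`
    set v := b ^ j * Real.log N₀ with hv
    have hv0 : 0 ≤ v := by positivity
    have h1 : 2 * horizon N₀ b β c * amp N₀ b β (j + 1) ≤ 2 * c * Real.exp (β * b * v) := by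
      rw [horizon, amp_eq_exp hN₀0, amp_eq_exp hN₀0]
      rw [show 2 * (c / Real.exp (β * b ^ 0 * Real.log N₀)) * Real.exp (β * b ^ (j + 1) * Real.log N₀) =
          2 * c * Real.exp (β * b ^ (j + 1) * Real.log N₀ - β * b ^ 0 * Real.log N₀) by
            rw [Real.exp_sub]; ring]
      refine mul_le_mul_of_nonneg_left (Real.exp_le_exp.2 ?_) (by positivity)
      have : β * b ^ (j + 1) * Real.log N₀ = β * b * v := by rw [hv]; ring
      rw [this, pow_zero, mul_one]
      linarith [mul_nonneg hβ.le hL]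
    have h2 : Real.exp (amp N₀ b β (j + 1) / 2 * tAct N₀ b β c (j + 1 + 1)) =
        Real.exp (-(c / 2 * Real.exp (β * (b - 1) * v))) := by
      have hr := amp_succ_div hN₀0 b β j
      rw [show β * (b - 1) * b ^ j * Real.log N₀ = β * (b - 1) * v by rw [hv]; ring] at hr
      rw [show j + 1 + 1 = j + 2 from rfl, tAct_add_two, ← hr]
      congr 1; ring
    rw [h2]
    calc 2 * horizon N₀ b β c * amp N₀ b β (j + 1) * Real.exp (-(c / 2 * Real.exp (β * (b - 1) * v)))
        ≤ 2 * c * Real.exp (β * b * v) * Real.exp (-(c / 2 * Real.exp (β * (b - 1) * v))) :=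
          mul_le_mul_of_nonneg_right h1 (Real.exp_pos _).le
      _ = 2 * c * (Real.exp (β * b * v) * Real.exp (-(c / 2 * Real.exp (β * (b - 1) * v)))) := by ring
      _ ≤ 1 := hN₀ j

/-- (visc), the absorption of the dissipation on `[t_k, 0]` in Prop. 3.4
(`η_{k-1} - ρ_k N_k² ≥ ¾A_{k-1} - N_k² ≥ ½A_{k-1}`, "using … that `β > 2b`, and taking `N₀` large"),
with the viscosity `ν` carried along, at level `k+1`: for all large `N₀` and all `k`,
`ν N_{k+1}² ≤ ¼ A_k`. [cite: Palasek2026ElementaryModel, Prop. 3.4 proof, p. 10] -/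
theorem eventually_visc (hb : 1 < b) (hβ : 2 * b < β) (ν : ℝ) :
    ∀ᶠ N₀ : ℝ in atTop, ∀ k : ℕ,
      ν * scale N₀ b (k + 1) ^ 2 ≤ amp N₀ b β k / 4 := by
  have hκ : 0 < β - 2 * b := sub_pos.2 hβ
  have hP : ∀ᶠ v : ℝ in atTop, 4 * ν * Real.exp (-((β - 2 * b) * v)) ≤ 1 := by
    have h := (tendsto_exp_neg_mul hκ).const_mul (4 * ν)
    rw [mul_zero] at h
    filter_upwards [h.eventually (gt_mem_nhds (by norm_num : (0:ℝ) < 1))] with v hv using hv.le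
  filter_upwards [eventually_forall_log_scale hb.le hP, eventually_gt_atTop 0] with N₀ hN₀ hN₀0 k
  set v := b ^ k * Real.log N₀ with hv
  have h1 : scale N₀ b (k + 1) ^ 2 = Real.exp (2 * b * v) := by
    rw [scale_eq_exp hN₀0, exp_sq]; congr 1; rw [hv]; ring
  have h2 : amp N₀ b β k = Real.exp (β * v) := by rw [amp_eq_exp hN₀0]; congr 1; rw [hv]; ring
  rw [h1, h2]
  have key : ν * Real.exp (2 * b * v) = (4 * ν * Real.exp (-((β - 2 * b) * v))) * (Real.exp (β * v) / 4) := by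
    rw [show Real.exp (2 * b * v) = Real.exp (-((β - 2 * b) * v)) * Real.exp (β * v) by
      rw [← Real.exp_add]; congr 1; ring]
    ring
  rw [key]
  calc 4 * ν * Real.exp (-((β - 2 * b) * v)) * (Real.exp (β * v) / 4)
      ≤ 1 * (Real.exp (β * v) / 4) := mul_le_mul_of_nonneg_right (hN₀ k) (by positivity)
    _ = Real.exp (β * v) / 4 := one_mul _

/-- (S4), the face `x_k = ζ_k`, `t < t_k`, `k ≥ 3` of the trapping argument
(`η_{k-1}η_k/(δ_kζ_{k+1}²) ≳ (A_{k-1}A_k/δ_kA_{k+1}²)·exp(-5A_{k-1}/A_{k-2} - 5A_{k-2}/A_{k-3} + cA_k/A_{k-1}) ≥ 1`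
by (ratios) and (exp_small)), at level `k+3`: for all large `N₀` and all `k`,
`δ_{k+3} (2A_{k+4} e^{½A_{k+3}t_{k+4}})² ≤ (A_{k+2}e^{-5A_{k+1}/A_k}) · (A_{k+3}e^{-5A_{k+2}/A_{k+1}})`.
[cite: Palasek2026ElementaryModel, Prop. 3.3 proof, p. 9] -/
theorem eventually_S4 (hb : 1 < b) (hβ : 0 < β) (hc : 0 < c) (α : ℝ) :
    ∀ᶠ N₀ : ℝ in atTop, ∀ k : ℕ,
      delta N₀ b α (k + 3) *
          (2 * amp N₀ b β (k + 4) * Real.exp (amp N₀ b β (k + 3) / 2 * tAct N₀ b β c (k + 4))) ^ 2 ≤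
        (amp N₀ b β (k + 2) * Real.exp (-(5 * amp N₀ b β (k + 1) / amp N₀ b β k))) *
          (amp N₀ b β (k + 3) * Real.exp (-(5 * amp N₀ b β (k + 2) / amp N₀ b β (k + 1)))) := by
  -- rates: `g₀ = β(b-1)` (`A_{k+1}/A_k`), `g₁ = g₀ b`, `g₂ = g₀ b²`; prefactor exponent `D`
  set g₀ := β * (b - 1) with hg₀
  set D := 2 * β * b ^ 4 - 2 * α * (b - 1) * b ^ 3 - β * b ^ 2 - β * b ^ 3 with hD
  have hg₀pos : 0 < g₀ := mul_pos hβ (sub_pos.2 hb)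
  have hg12 : g₀ * b < g₀ * b ^ 2 := by
    rw [sq, ← mul_assoc]; exact lt_mul_right (mul_pos hg₀pos (by linarith)) hb
  have hP1 : ∀ᶠ v : ℝ in atTop,
      4 * (Real.exp (D * v) * Real.exp (-(c / 2 * Real.exp (g₀ * b ^ 2 * v)))) ≤ 1 := by
    have h := (tendsto_exp_mul_exp_neg_exp D (half_pos hc) (by positivity : 0 < g₀ * b ^ 2)).const_mul 4
    rw [mul_zero] at h
    filter_upwards [h.eventually (gt_mem_nhds (by norm_num : (0:ℝ) < 1))] with v hv using hv.le
  have hP2 : ∀ᶠ v : ℝ in atTop, 10 * Real.exp (g₀ * b * v) ≤ c / 2 * Real.exp (g₀ * b ^ 2 * v) :=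
    eventually_mul_exp_le_mul_exp 10 (half_pos hc) hg12
  filter_upwards [eventually_forall_log_scale hb.le (hP1.and hP2), eventually_ge_atTop 1]
    with N₀ hN₀ hN₀1 k
  have hN₀0 : 0 < N₀ := by linarith
  have hb0 : 0 < b := by linarith
  obtain ⟨h1, h2⟩ := hN₀ k
  set v := b ^ k * Real.log N₀ with hv
  have hv0 : 0 ≤ v := by have := Real.log_nonneg hN₀1; positivity
  -- closed forms
  have hA : ∀ j : ℕ, amp N₀ b β (k + j) = Real.exp (β * b ^ j * v) := by
    intro j; rw [amp_eq_exp hN₀0]; congr 1; rw [hv, pow_add]; ring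
  have hr : ∀ j : ℕ, amp N₀ b β (k + j + 1) / amp N₀ b β (k + j) = Real.exp (g₀ * b ^ j * v) := by
    intro j; rw [amp_succ_div hN₀0]; congr 1; rw [hv, hg₀, pow_add]; ring
  have hδ : delta N₀ b α (k + 3) = Real.exp (-(2 * α * (b - 1)) * b ^ 3 * v) := by
    rw [delta_eq_exp hN₀0]; congr 1; rw [hv, pow_add]; ring
  have ht : amp N₀ b β (k + 3) / 2 * tAct N₀ b β c (k + 4) = -(c / 2 * Real.exp (g₀ * b ^ 2 * v)) := by
    rw [show k + 4 = (k + 2) + 2 from rfl, tAct_add_two, ← hr 2]; ring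
  have hq1 : 5 * amp N₀ b β (k + 1) / amp N₀ b β k = 5 * Real.exp (g₀ * v) := by
    have := hr 0; simp only [add_zero, pow_zero, mul_one] at this; rw [mul_div_assoc, this]
  have hq2 : 5 * amp N₀ b β (k + 2) / amp N₀ b β (k + 1) = 5 * Real.exp (g₀ * b * v) := by
    have := hr 1; simp only [pow_one] at this; rw [mul_div_assoc, this]
  -- LHS closed form
  have lhs : delta N₀ b α (k + 3) *
        (2 * amp N₀ b β (k + 4) * Real.exp (amp N₀ b β (k + 3) / 2 * tAct N₀ b β c (k + 4))) ^ 2 =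
      4 * (Real.exp (D * v) * Real.exp (-(c / 2 * Real.exp (g₀ * b ^ 2 * v)))) *
        (Real.exp ((β * b ^ 2 + β * b ^ 3) * v) * Real.exp (-(c / 2 * Real.exp (g₀ * b ^ 2 * v)))) := by
    rw [ht, hδ, hA 4, mul_pow, mul_pow, exp_sq, exp_sq]
    have e1 : ∀ x y z : ℝ, Real.exp x * ((2:ℝ) ^ 2 * Real.exp y * Real.exp z) =
        4 * Real.exp (x + y + z) := by
      intro x y z; rw [Real.exp_add, Real.exp_add]; ring
    have e2 : ∀ x y z w : ℝ, 4 * (Real.exp x * Real.exp y) * (Real.exp z * Real.exp w) =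
        4 * Real.exp (x + y + z + w) := by
      intro x y z w; rw [Real.exp_add, Real.exp_add, Real.exp_add]; ring
    rw [e1, e2]
    congr 2
    rw [hD]; ring
  -- RHS lower bound
  have rhs : Real.exp ((β * b ^ 2 + β * b ^ 3) * v) * Real.exp (-(c / 2 * Real.exp (g₀ * b ^ 2 * v))) ≤
      (amp N₀ b β (k + 2) * Real.exp (-(5 * amp N₀ b β (k + 1) / amp N₀ b β k))) *
        (amp N₀ b β (k + 3) * Real.exp (-(5 * amp N₀ b β (k + 2) / amp N₀ b β (k + 1)))) := by
    rw [hq1, hq2, hA 2, hA 3]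
    rw [show Real.exp (β * b ^ 2 * v) * Real.exp (-(5 * Real.exp (g₀ * v))) *
        (Real.exp (β * b ^ 3 * v) * Real.exp (-(5 * Real.exp (g₀ * b * v)))) =
        Real.exp ((β * b ^ 2 + β * b ^ 3) * v) *
          Real.exp (-(5 * Real.exp (g₀ * v) + 5 * Real.exp (g₀ * b * v))) by
      rw [← Real.exp_add, ← Real.exp_add, ← Real.exp_add, ← Real.exp_add]; congr 1; ring]
    refine mul_le_mul_of_nonneg_left (Real.exp_le_exp.2 (neg_le_neg ?_)) (Real.exp_pos _).le
    have h01 : Real.exp (g₀ * v) ≤ Real.exp (g₀ * b * v) := by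
      rw [Real.exp_le_exp]
      have : g₀ * v * 1 ≤ g₀ * v * b := mul_le_mul_of_nonneg_left hb.le (by positivity)
      linarith
    linarith
  rw [lhs]
  calc 4 * (Real.exp (D * v) * Real.exp (-(c / 2 * Real.exp (g₀ * b ^ 2 * v)))) *
        (Real.exp ((β * b ^ 2 + β * b ^ 3) * v) * Real.exp (-(c / 2 * Real.exp (g₀ * b ^ 2 * v))))
      ≤ 1 * (Real.exp ((β * b ^ 2 + β * b ^ 3) * v) * Real.exp (-(c / 2 * Real.exp (g₀ * b ^ 2 * v)))) :=
        mul_le_mul_of_nonneg_right h1 (by positivity)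
    _ = _ := one_mul _
    _ ≤ _ := rhs

end Smallness

end PalasekObukhov

end Literature.Analysis.FluidPDE
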